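import Summits.CriticalPhenomena.CardyFormulaZ2.Theorems.ModulusResponseSegmentRSWIffNonSlant
import Summits.CriticalPhenomena.CardyFormulaZ2.Theorems.CardySelfDualSegmentUniformBoxCrossingSplit
import HarnessLib

/-!
# Line `endpoint_halves` for crux `SegmentRSW` (stmt-CriticalPhenomena-6470) — crux-strategist s1, 2026-08-17

ALTERNATIVE line, published but NOT registered (the live skeleton pointer stays on `Lines/birth.lean`,
lead c11; a continuation lead may register this file with
`ledger skeleton check $(ledger crux dir stmt-CriticalPhenomena-6470)/Lines/endpoint_halves.lean --crux stmt-CriticalPhenomena-6470`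
at a cycle boundary). It re-cuts the one open stub of `birth` (`stub_nonSlant : NonSlantStatement`, the
kernel, ⟺ the crux by p146906) into the two HALVES OF ENDPOINT DOMINATION of the corner family — the
decomposition whose glue the strategist landed as
`Summit.CriticalPhenomena.CardyFormulaZ2.Cruxes.SegmentRSW.Split.SegmentRSW_of_subs` (p172761) and whose
route-level filing (`route edit --split SegmentRSW`) the gate reserves to a final-cycle seat / tenure
planner (package `Cruxes/SegmentRSW/SPLIT-EndpointDomination.md`). The two stubs are byte-identical to
the sibling package for stmt-CriticalPhenomena-5476 (`Cruxes/UniformBoxCrossing/SPLIT-EndpointDomination.md`)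
and are the targets of the sibling's live research stubs `stub_microcanonicalU/W`
(Theorems/CardySelfDualSegmentUniformBoxCrossingOfMicrocanonical.lean: MM-U ⇒ ED-U, MM-W ⇒ ED-W) — do NOT
seat workers here that duplicate those.

* `stub_endpointDominationU` — for every t ∈ [0,1], u-crossings of the turned m × 2m boxes are at least as
  likely under M_t as under M_0 (site-𝕋 of corners = this route's Smirnov point u = 0), eventually in m,
  every integer position (λ_t ≤ λ_0 = √3). Open; exact for m ≤ 3 in the summed form; the atomic
  per-(environment, corner) form is FALSE from m = 5 (sibling kit j024047).
* `stub_endpointDominationW` — w-crossings of the turned 2m × m boxes at least as likely under M_t as under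
  M_1 (bond-ℤ² at 1/2 = this route's u = 1/2) (λ_t ≥ 1). Open; atomic form FALSE from m = 3; ψ-monotone /
  microcanonical forms robust to m = 6 (sibling kit j024226).

Composition `SegmentRSW_of` is the landed glue (its proof term inlined), so this file has sorries ONLY in the two stubs.
-/

namespace Summit.CriticalPhenomena.CardyFormulaZ2.Cruxes.SegmentRSW.EndpointHalves

/-- ENDPOINT DOMINATION, u-half (open research stub; = child `EndpointDominationU` of the strategist's
split package; anchor t = 0). -/
theorem stub_endpointDominationU : let prm : unitInterval → Literature.Probability.LatticeModels.Site 2 × Fin 2 → unitInterval := fun t i => if i.2 = 0 then Literature.Probability.Percolation.half else Literature.Probability.Percolation.half * t; let cfg : Set (Literature.Probability.LatticeModels.Site 2 × Fin 2) → Literature.Probability.Percolation.BondConfig (Literature.Probability.LatticeModels.Site 2) := fun S => {e | ∃ v : Literature.Probability.LatticeModels.Site 2, (e = s(v, v + ![1, 0]) ∧ (v, (0 : Fin 2)) ∈ S) ∨ (e = s(v, v + ![0, 1]) ∧ ((v, (0 : Fin 2)) ∈ S ↔ (v, (1 : Fin 2)) ∉ S))}; let M : unitInterval → MeasureTheory.Measure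 (Literature.Probability.Percolation.BondConfig (Literature.Probability.LatticeModels.Site 2)) := fun t => (Literature.Probability.LatticeModels.prodBernoulli (prm t)).map cfg; let dia : ℤ → ℤ → Literature.Probability.LatticeModels.Site 2 → ℂ := fun A B v => ((v 0 - v 1 : ℤ) : ℂ) + ((v 0 + v 1 : ℤ) : ℂ) * Complex.I - ((A : ℂ) + (B : ℂ) * Complex.I); ∃ m₁ : ℕ, ∀ m : ℕ, m₁ ≤ m → ∀ (A B : ℤ) (t : unitInterval), (M 0).real (Literature.Probability.LatticeModels.embTBCrossing (dia A B) m (2 * m)) ≤ (M t).real (Literature.Probability.LatticeModels.embTBCrossing (dia A B) m (2 * m)) := by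
  sorry

/-- ENDPOINT DOMINATION, w-half (open research stub; = child `EndpointDominationW`; anchor t = 1). -/
theorem stub_endpointDominationW : let prm : unitInterval → Literature.Probability.LatticeModels.Site 2 × Fin 2 → unitInterval := fun t i => if i.2 = 0 then Literature.Probability.Percolation.half else Literature.Probability.Percolation.half * t; let cfg : Set (Literature.Probability.LatticeModels.Site 2 × Fin 2) → Literature.Probability.Percolation.BondConfig (Literature.Probability.LatticeModels.Site 2) := fun S => {e | ∃ v : Literature.Probability.LatticeModels.Site 2, (e = s(v, v + ![1, 0]) ∧ (v, (0 : Fin 2)) ∈ S) ∨ (e = s(v, v + ![0, 1]) ∧ ((v, (0 : Fin 2)) ∈ S ↔ (v, (1 : Fin 2)) ∉ S))}; let M : unitInterval → MeasureTheory.Measure (Literature.Probability.Percolation.BondConfig (Literature.Probability.LatticeModels.Site 2)) := fun t => (Literature.Probability.LatticeModels.prodBernoulli (prm t)).map cfg; let dia : ℤ → ℤ → Literature.Probability.LatticeModels.Site 2 → ℂ := fun A B v => ((v 0 - v 1 : ℤ) : ℂ) + ((v 0 + v 1 : ℤ) : ℂ) * Complex.I - ((A : ℂ) + (B : ℂ)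 * Complex.I); ∃ m₁ : ℕ, ∀ m : ℕ, m₁ ≤ m → ∀ (A B : ℤ) (t : unitInterval), (M 1).real (Literature.Probability.LatticeModels.embRectCrossing (dia A B) (2 * m) m) ≤ (M t).real (Literature.Probability.LatticeModels.embRectCrossing (dia A B) (2 * m) m) := by
  sorry

/-- Composition: the two halves give the crux BY NAME (landed glue `Split.SegmentRSW_of_subs`, p172761:
`uniformBoxCrossing_of_endpointDominationU_W` ∘ `Iff.rfl` ∘ `segmentRSW_of_uniformBoxCrossing`). -/
theorem SegmentRSW_of : (let prm : unitInterval → Literature.Probability.LatticeModels.Site 2 × Fin 2 → unitInterval := fun t i => if i.2 = 0 then Literature.Probability.Percolation.half else Literature.Probability.Percolation.half * t; let cfg : Set (Literature.Probability.LatticeModels.Site 2 × Fin 2) → Literature.Probability.Percolation.BondConfig (Literature.Probability.LatticeModels.Site 2) := fun S => {e | ∃ v : Literature.Probability.LatticeModels.Site 2, (e = s(v, v + ![1, 0]) ∧ (v, (0 : Fin 2)) ∈ S) ∨ (e = s(v, v + ![0, 1]) ∧ ((v, (0 : Fin 2)) ∈ S ↔ (v, (1 : Fin 2)) ∉ S))};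 let M : unitInterval → MeasureTheory.Measure (Literature.Probability.Percolation.BondConfig (Literature.Probability.LatticeModels.Site 2)) := fun t => (Literature.Probability.LatticeModels.prodBernoulli (prm t)).map cfg; let dia : ℤ → ℤ → Literature.Probability.LatticeModels.Site 2 → ℂ := fun A B v => ((v 0 - v 1 : ℤ) : ℂ) + ((v 0 + v 1 : ℤ) : ℂ) * Complex.I - ((A : ℂ) + (B : ℂ) * Complex.I); ∃ m₁ : ℕ, ∀ m : ℕ, m₁ ≤ m → ∀ (A B : ℤ) (t : unitInterval), (M 0).real (Literature.Probability.LatticeModels.embTBCrossing (dia A B) m (2 * m)) ≤ (M t).real (Literature.Probability.LatticeModels.embTBCrossing (dia A B) m (2 * m))) → (let prm : unitInterval → Literature.Probability.LatticeModels.Site 2 × Fin 2 → unitInterval := fun t i => if i.2 = 0 then Literature.Probability.Percolation.half else Literature.Probability.Percolation.half * t; let cfg : Set (Literature.Probability.LatticeModels.Site 2 × Fin 2) → Literature.Probability.Percolation.BondConfig (Literature.Probability.LatticeModels.Site 2) := fun S => {e | ∃ v : Literature.Probability.LatticeModels.Site 2, (e = s(v, v + ![1, 0]) ∧ (v, (0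 : Fin 2)) ∈ S) ∨ (e = s(v, v + ![0, 1]) ∧ ((v, (0 : Fin 2)) ∈ S ↔ (v, (1 : Fin 2)) ∉ S))}; let M : unitInterval → MeasureTheory.Measure (Literature.Probability.Percolation.BondConfig (Literature.Probability.LatticeModels.Site 2)) := fun t => (Literature.Probability.LatticeModels.prodBernoulli (prm t)).map cfg; let dia : ℤ → ℤ → Literature.Probability.LatticeModels.Site 2 → ℂ := fun A B v => ((v 0 - v 1 : ℤ) : ℂ) + ((v 0 + v 1 : ℤ) : ℂ) * Complex.I - ((A : ℂ) + (B : ℂ) * Complex.I); ∃ m₁ : ℕ, ∀ m : ℕ, m₁ ≤ m → ∀ (A B : ℤ) (t : unitInterval), (M 1).real (Literature.Probability.LatticeModels.embRectCrossing (dia A B) (2 * m) m) ≤ (M t).real (Literature.Probability.LatticeModels.embRectCrossing (dia A B) (2 * m) m)) →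
    Summit.CriticalPhenomena.CardyFormulaZ2.Theses.ModulusResponse.SegmentRSW :=
  -- literally the landed glue `Split.SegmentRSW_of_subs` (p172761), inlined so that this file does not
  -- depend on the freshly landed module while farm snapshots catch up
  fun hU hW =>
    Summit.CriticalPhenomena.CardyFormulaZ2.Cruxes.SegmentRSW.Birth.segmentRSW_of_uniformBoxCrossing
      (Summit.CriticalPhenomena.CardyFormulaZ2.Cruxes.UniformBoxCrossing.NonSlantLine.uniformBoxCrossing_iff_boxCrossingBounds_cornerPercolation.2
        (Summit.CriticalPhenomena.CardyFormulaZ2.Cruxes.UniformBoxCrossing.NonSlantLine.uniformBoxCrossing_of_endpointDominationU_W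
          hU hW))

/-- The crux from the registered stubs of this line. -/
theorem SegmentRSW_holds_of_line :
    Summit.CriticalPhenomena.CardyFormulaZ2.Theses.ModulusResponse.SegmentRSW :=
  SegmentRSW_of stub_endpointDominationU stub_endpointDominationW

end Summit.CriticalPhenomena.CardyFormulaZ2.Cruxes.SegmentRSW.EndpointHalves
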